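import Summits.CriticalPhenomena.SAWScalingLimit.Theorems.SAWDevelopingMapNoFoldBoundThreeClassMin

/-!
# `NoFoldBound`, line Ideator3Sketch — the three-class inequality, NECESSITY of middle-port balance

Crux `NoFoldBound` (stmt-CriticalPhenomena-8296), route `SAWDevelopingMap`, lead seat c5 (wave 1, stub
`three_class_necessary`). The files `…ThreeClass` / `…ThreeClassMin` prove SUFFICIENT conditions (middle-port
balance / dominance) for the depth-2 no-fold inequality
`‖b₀ + b₁ e^{13πi/12} + b₂ e^{−13πi/12}‖ ≤ k ‖s₀ + s₁ e^{5πi/12} + s₂ e^{−5πi/12}‖`.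
This file proves the CONVERSE direction used by `noStarvation_of_noFoldBound`: if the inequality holds with ANY
`k ≤ 1`, and the dressed masses only satisfy the one-sided facts `b₀ ≤ s₀` (middle port) and
`b_j ≥ 0.6137 s_j` (outer ports, `β_T/α_T ≥ 0.6137`), then the middle mass cannot be starved while the outer two
are balanced: `2·min(s₁, s₂) ≤ 3·s₀ + max(s₁, s₂)`.

* `three_class_nec_core` — the real-arithmetic core (`C = cos(π/12)`, `σ = sin(π/12)` abstracted with the
  enclosures `0.9659 ≤ C ≤ 0.96593`, `0 ≤ σ ≤ 0.2589`), case `s₂ ≤ s₁`;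
* `three_class_necessary` — the statement on the complex norms.

Pure real/complex algebra; nothing about walks is used or asserted. [folklore]
-/

noncomputable section

namespace Summit.CriticalPhenomena.SAWScalingLimit.Theorems.SAWDevelopingMapNoFoldBound

open Complex

/-- The real-arithmetic core of `three_class_necessary` (`C = cos(π/12)`, `σ = sin(π/12)` abstracted with their
enclosures), case `s₂ ≤ s₁`: from the linearised no-fold inequality
`(b₁ + b₂) C − b₀ ≤ s₀ + (s₁ + s₂) σ + (s₁ − s₂) C` and the one-sided dressing facts, `2 s₂ ≤ 3 s₀ + s₁`.
[folklore] -/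
theorem three_class_nec_core {s₀ s₁ s₂ b₀ b₁ b₂ C σ : ℝ}
    (hs₁ : 0 ≤ s₁) (hs₂ : 0 ≤ s₂) (h21 : s₂ ≤ s₁)
    (hb₀u : b₀ ≤ s₀) (hb₁l : 6137 / 10000 * s₁ ≤ b₁) (hb₂l : 6137 / 10000 * s₂ ≤ b₂)
    (hCl : (9659 / 10000 : ℝ) ≤ C) (hCu : C ≤ (96593 / 100000 : ℝ)) (hσu : σ ≤ (2589 / 10000 : ℝ))
    (hXU : (b₁ + b₂) * C - b₀ ≤ s₀ + (s₁ + s₂) * σ + (s₁ - s₂) * C) :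
    2 * s₂ ≤ 3 * s₀ + s₁ := by
  have hC0 : 0 ≤ C := by linarith
  -- lower bound of the Beltrami side: `(b₁ + b₂) C ≥ 0.6137 C (s₁ + s₂)`
  have hbC : 6137 / 10000 * (s₁ + s₂) * C ≤ (b₁ + b₂) * C :=
    mul_le_mul_of_nonneg_right (by linarith) hC0
  -- product enclosures
  have p1 : C * s₁ ≤ (96593 / 100000 : ℝ) * s₁ := mul_le_mul_of_nonneg_right hCu hs₁
  have p2 : (9659 / 10000 : ℝ) * s₂ ≤ C * s₂ := mul_le_mul_of_nonneg_right hCl hs₂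
  have p3 : σ * s₁ ≤ (2589 / 10000 : ℝ) * s₁ := mul_le_mul_of_nonneg_right hσu hs₁
  have p4 : σ * s₂ ≤ (2589 / 10000 : ℝ) * s₂ := mul_le_mul_of_nonneg_right hσu hs₂
  -- `2 s₀ ≥ (0.6137 C − σ − C) s₁ + (0.6137 C − σ + C) s₂ ≥ −0.63204 s₁ + 1.29977 s₂`
  have key : -(63204 / 100000 : ℝ) * s₁ + (129977 / 100000 : ℝ) * s₂ ≤ 2 * s₀ := by nlinarith
  nlinarith

/-- **The three-class inequality, necessity of middle-port balance (depth-2 stratum).** Real masses: middle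
class `s₀, b₀`, neighbouring classes `s₁, b₁` and `s₂, b₂` with `s_j ≥ 0`, `b₀ ≤ s₀`, `b_j ≥ 0.6137 s_j`
(`j = 1, 2`). If the depth-2 no-fold inequality
`‖b₀ + b₁ e^{13πi/12} + b₂ e^{−13πi/12}‖ ≤ k ‖s₀ + s₁ e^{5πi/12} + s₂ e^{−5πi/12}‖` holds for some `k ≤ 1`, then
`2·min(s₁, s₂) ≤ 3·s₀ + max(s₁, s₂)` — the converse companion of `three_class_bound_min'`. [folklore] -/
theorem three_class_necessary {s₀ s₁ s₂ b₀ b₁ b₂ k : ℝ}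
    (hs₀ : 0 ≤ s₀) (hs₁ : 0 ≤ s₁) (hs₂ : 0 ≤ s₂) (hk : k ≤ 1)
    (hb₀u : b₀ ≤ s₀) (hb₁l : 6137 / 10000 * s₁ ≤ b₁) (hb₂l : 6137 / 10000 * s₂ ≤ b₂)
    (h : ‖(b₀ : ℂ) + b₁ * Complex.exp ((13 * Real.pi / 12 : ℝ) * Complex.I) +
        b₂ * Complex.exp (-((13 * Real.pi / 12 : ℝ) * Complex.I))‖ ≤
      k * ‖(s₀ : ℂ) + s₁ * Complex.exp ((5 * Real.pi / 12 : ℝ) * Complex.I) +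
        s₂ * Complex.exp (-((5 * Real.pi / 12 : ℝ) * Complex.I))‖) :
    2 * min s₁ s₂ ≤ 3 * s₀ + max s₁ s₂ := by
  obtain ⟨_, hC2u, _, hσ2u, hCl, hσl⟩ := trig_pi_div_twelve_bounds
  set C := Real.cos (Real.pi / 12) with hCdef
  set σ := Real.sin (Real.pi / 12) with hσdef
  have hC0 : 0 ≤ C := by linarith
  have hσ0 : 0 ≤ σ := by linarith
  -- `C ≤ 0.96593`, `σ ≤ 0.2589` from the enclosures of the squares
  have hCu : C ≤ (96593 / 100000 : ℝ) := by nlinarith [sq_nonneg (C + 96593 / 100000)]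
  have hσu : σ ≤ (2589 / 10000 : ℝ) := by nlinarith [sq_nonneg (σ + 2589 / 10000)]
  -- the two norms as real expressions
  have eB : ‖(b₀ : ℂ) + b₁ * Complex.exp ((13 * Real.pi / 12 : ℝ) * Complex.I) +
        b₂ * Complex.exp (-((13 * Real.pi / 12 : ℝ) * Complex.I))‖ ^ 2 =
      (b₀ - (b₁ + b₂) * C) ^ 2 + ((b₁ - b₂) * σ) ^ 2 := by
    rw [three_class_normSq_eq, cos_thirteen_pi_div_twelve, sin_thirteen_pi_div_twelve]; ring
  have eS : ‖(s₀ : ℂ) + s₁ * Complex.exp ((5 * Real.pi / 12 : ℝ) * Complex.I) +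
        s₂ * Complex.exp (-((5 * Real.pi / 12 : ℝ) * Complex.I))‖ ^ 2 =
      (s₀ + (s₁ + s₂) * σ) ^ 2 + ((s₁ - s₂) * C) ^ 2 := by
    rw [three_class_normSq_eq, cos_five_pi_div_twelve, sin_five_pi_div_twelve]
  -- `‖B‖ ≤ ‖S‖` since `k ≤ 1`
  have hBS : ‖(b₀ : ℂ) + b₁ * Complex.exp ((13 * Real.pi / 12 : ℝ) * Complex.I) +
        b₂ * Complex.exp (-((13 * Real.pi / 12 : ℝ) * Complex.I))‖ ≤
      ‖(s₀ : ℂ) + s₁ * Complex.exp ((5 * Real.pi / 12 : ℝ) * Complex.I) +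
        s₂ * Complex.exp (-((5 * Real.pi / 12 : ℝ) * Complex.I))‖ :=
    h.trans (mul_le_of_le_one_left (norm_nonneg _) hk)
  have hsq := pow_le_pow_left₀ (norm_nonneg _) hBS 2
  rw [eB, eS] at hsq
  -- `X := (b₁ + b₂) C − b₀ ≤ U := s₀ + (s₁ + s₂) σ + |s₁ − s₂| C`
  set U := s₀ + (s₁ + s₂) * σ + |s₁ - s₂| * C with hUdef
  have hU1 : 0 ≤ s₀ + (s₁ + s₂) * σ := by positivity
  have hU2 : 0 ≤ |s₁ - s₂| * C := by positivity
  have hU0 : 0 ≤ U := add_nonneg hU1 hU2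
  have hXsq : ((b₁ + b₂) * C - b₀) ^ 2 ≤ U ^ 2 := by
    have e1 : ((b₁ + b₂) * C - b₀) ^ 2 = (b₀ - (b₁ + b₂) * C) ^ 2 := by ring
    have e2 : ((s₁ - s₂) * C) ^ 2 = (|s₁ - s₂| * C) ^ 2 := by rw [mul_pow, mul_pow, sq_abs]
    have h3 : (s₀ + (s₁ + s₂) * σ) ^ 2 + (|s₁ - s₂| * C) ^ 2 ≤ U ^ 2 := by
      rw [hUdef]; nlinarith [mul_nonneg hU1 hU2]
    nlinarith [sq_nonneg ((b₁ - b₂) * σ), e1, e2, h3, hsq]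
  have hXU : (b₁ + b₂) * C - b₀ ≤ U := (abs_le_of_sq_le_sq' hXsq hU0).2
  rcases le_total s₂ s₁ with h21 | h12
  · rw [min_eq_right h21, max_eq_left h21]
    have habs : |s₁ - s₂| = s₁ - s₂ := abs_of_nonneg (sub_nonneg.2 h21)
    rw [hUdef, habs] at hXU
    exact three_class_nec_core hs₁ hs₂ h21 hb₀u hb₁l hb₂l hCl hCu hσu hXU
  · rw [min_eq_left h12, max_eq_right h12]
    have habs : |s₁ - s₂| = s₂ - s₁ := by
      rw [abs_sub_comm]; exact abs_of_nonneg (sub_nonneg.2 h12)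
    rw [hUdef, habs] at hXU
    exact three_class_nec_core hs₂ hs₁ h12 hb₀u hb₂l hb₁l hCl hCu hσu (by linarith)
    
end Summit.CriticalPhenomena.SAWScalingLimit.Theorems.SAWDevelopingMapNoFoldBound
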